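import Literature.Analysis.FluidPDE.VorticityCalculus
import Literature.Analysis.FluidPDE.ClassicalSolutionCalculus
import Literature.Analysis.FluidPDE.PressurePoisson
import HarnessLib

/-!
# The viscosity rescaling `v(s, x) = ν⁻¹ u(s/ν, x)` of classical Navier–Stokes solutions

Analysis/FluidPDE support file (serves the decomposition of Tao 2011, Cor. 11.4,
`Literature.Analysis.FluidPDE.tao_unconditional_uniqueness`, whose leaves — Prop. 9.1 *bounded total speed*,
Thm. 10.1 *enstrophy localisation* — are printed for unit viscosity). Tao normalises `ν = 1`
(arXiv:1108.1165, footnote 3, p. 4: "One can of course generalise … to other viscosities `ν > 0`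
by a simple rescaling argument"); the tree states the corresponding named facts for every
`ν > 0` with `ν`-dependent constants. This file **proves** the rescaling that links the two: if
`(u, p)` is a classical solution of `∂ₜu + (u·∇)u = νΔu − ∇p + f`, `div u = 0` on the slab
`[0, T] × X`, then
`v(s, x) = ν⁻¹ u(s/ν, x)`, `q(s, x) = ν⁻² p(s/ν, x)`, `g(s, x) = ν⁻² f(s/ν, x)`
is a classical solution with viscosity `1` on `[0, νT] × X`
(`IsClassicalNSSolutionOn.viscosityRescale`), together with the bookkeeping of the quantities
entering Tao's statements: kinetic energy `∫|v(s)|² = ν⁻²∫|u(s/ν)|²`, vorticity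
`curl v(s) = ν⁻¹ curl u(s/ν)` and its gradient, dissipation density `|∇v(s)|² = ν⁻²|∇u(s/ν)|²`,
and the time change of variables `∫₀^{νT} G(s/ν) ds = ν ∫₀ᵀ G(t) dt` for lower Lebesgue
integrals (the `L^∞` bookkeeping `‖v(s)‖_{L^∞} = ν⁻¹‖u(s/ν)‖_{L^∞}` is just Mathlib's
`eLpNorm_const_smul` applied to `timeRescale_slice`, and is done where it is used,
`TaoUnitViscosity.eLpNorm_timeRescale`).

All statements are written with the time dilation `Fluid.timeRescale a c w s x = c • w (a s) x`
(`a = ν⁻¹`, amplitude `c = ν⁻¹` for the velocity and `c = ν⁻²` for pressure and force), for an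
arbitrary time set `S` and its preimage `S'` under `s ↦ a s` where this costs nothing, and
specialised to `S = [0, T]`, `S' = [0, νT]`.

## Mathlib / tree search

Tree: the *parabolic* scaling `u ↦ c u(c²t, cx)` at fixed viscosity is `Fluid.nsRescale`
(`SelfSimilar`) / `NS.rescale` (`CriticalSpaces`); the general space–time affine pull-back
`Fluid.stPull β γ t₀ x₀ ψ (s, y) = ψ (t₀ + β s) (x₀ + γ y)` with amplitude `α` is treated in
`SpaceTimeRescaling` for fields on *open* space–time regions, where covariance is proved for the
distributional/weak notions (`IsDistributionalNSSolutionOn.stRescale`,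
`HasWeakSpatialGradientOn.stRescale`); pointwise `timeRescale a c w s x = c • stPull a 1 0 0 w s x`
(up to `0 + ·`, `1 • ·`). What is not in the tree (`lean search 'rescal|scaling|stPull'`) is the
statement for the *classical closed-slab* notion with one-sided time derivatives,
`IsClassicalNSSolutionOn S ν … → IsClassicalNSSolutionOn S' 1 …`, and the bookkeeping of the
energy/enstrophy quantities of Tao's statements; this file keeps the light imports of the
classical theory (`frobeniusNormSq_const_smul` below restates the three-line
`Fluid.frobeniusNormSq_smul` of `SpaceTimeRescaling` for that reason; likewise
`lintegral_comp_mul_left_eq` below is the `E = ℝ` case of the tree's `Fluid.lintegral_comp_smul`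
(`SolenoidalTruncation`, `finrank ℝ ℝ = 1`), whose imports are equally heavy). Mathlib:
`HasDerivWithinAt.scomp` (chain rule within sets), `laplacian_smul`, `fderiv_fun_const_smul`,
`Real.map_volume_mul_left` + `lintegral_map_equiv` (change of variables `s ↦ a s` on `ℝ`); tree:
`divergence_const_smul_apply` (`PressurePoisson`),
`Fluid.curl_const_smul`, `Fluid.contDiff_curl` (`VorticityCalculus`),
`IsSmoothSpaceTimeOn.differentiableWithinAt_time` (`ClassicalSolution`).

## References

* T. Tao, *Localisation and compactness properties of the Navier–Stokes global regularity
  problem*, Anal. PDE 6 (2013) 25–107 = arXiv:1108.1165, footnote 3 (p. 4) and (31) (scaling).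
* C. L. Fefferman, *Existence and smoothness of the Navier–Stokes equation* (Clay problem
  description), eqs. (1)–(2) (the system with viscosity `ν`). Bib key `Fefferman2000`.
-/

noncomputable section

open MeasureTheory Set Function Filter Topology InnerProductSpace
open scoped RealInnerProductSpace ENNReal NNReal Laplacian ContDiff

namespace Literature.Analysis.FluidPDE

/-! ### Time dilation with amplitude -/

section TimeRescale

variable {X : Type*} [NormedAddCommGroup X] [NormedSpace ℝ X]
variable {F : Type*} [NormedAddCommGroup F] [NormedSpace ℝ F]

/-- **Time dilation with amplitude** of a time-dependent field: `timeRescale a c w s x = c • w (a s) x`.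
For `a = ν⁻¹`: `c = ν⁻¹` gives Tao's rescaled velocity `v(s, x) = ν⁻¹u(s/ν, x)`, `c = ν⁻²` the
rescaled pressure `ν⁻²p(s/ν, x)` and force `ν⁻²f(s/ν, x)` (Tao 2011, footnote 3). [cite: Tao2011, footnote 3] -/
def timeRescale (a c : ℝ) (w : ℝ → X → F) : ℝ → X → F := fun s x => c • w (a * s) x

omit [NormedAddCommGroup X] [NormedSpace ℝ X] in
/-- Unfolding `timeRescale`. [folklore] -/
@[simp]
theorem timeRescale_apply (a c : ℝ) (w : ℝ → X → F) (s : ℝ) (x : X) :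
    timeRescale a c w s x = c • w (a * s) x := rfl

omit [NormedAddCommGroup X] [NormedSpace ℝ X] in
/-- The time slice of a rescaled field is a scalar multiple of a time slice. [folklore] -/
theorem timeRescale_slice (a c : ℝ) (w : ℝ → X → F) (s : ℝ) :
    timeRescale a c w s = fun x => c • w (a * s) x := rfl

omit [NormedAddCommGroup X] [NormedSpace ℝ X] in
/-- At time `0` the rescaled field is `c •` the original datum. [folklore] -/
theorem timeRescale_zero (a c : ℝ) (w : ℝ → X → F) :
    timeRescale a c w 0 = fun x => c • w 0 x := by
  simp [timeRescale_slice]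

/-- **Joint smoothness is preserved by time dilation**: if `w` is jointly smooth on `S × X` and
`s ↦ a s` maps `S'` into `S`, then `timeRescale a c w` is jointly smooth on `S' × X`. [folklore] -/
theorem IsSmoothSpaceTimeOn.timeRescale {S S' : Set ℝ} {w : ℝ → X → F}
    (h : IsSmoothSpaceTimeOn S w) (a c : ℝ) (hS' : MapsTo (fun s => a * s) S' S) :
    IsSmoothSpaceTimeOn S' (timeRescale a c w) := by
  have hφ : ContDiff ℝ ∞ (fun z : ℝ × X => ((a * z.1, z.2) : ℝ × X)) :=
    (contDiff_fst.const_smul a).prodMk contDiff_snd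
  have hmaps : MapsTo (fun z : ℝ × X => ((a * z.1, z.2) : ℝ × X)) (S' ×ˢ univ) (S ×ˢ univ) :=
    fun z hz => mk_mem_prod (hS' hz.1) (mem_univ _)
  have hcomp : ContDiffOn ℝ ∞ (uncurry w ∘ fun z : ℝ × X => ((a * z.1, z.2) : ℝ × X))
      (S' ×ˢ univ) := h.comp hφ.contDiffOn hmaps
  have := hcomp.const_smul c
  refine this.congr fun z _ => ?_
  obtain ⟨s, x⟩ := z
  simp

/-- **Chain rule for the one-sided time derivative under time dilation**:
`∂ₛ (c • w (a s) x) = (c a) • (∂ₜ w)(a s) x` within `S'` at `s ∈ S'`, where `S'` is a set of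
unique differentiability mapped into `S` by `s ↦ a s` and `w` is jointly smooth on `S × X`. [folklore] -/
theorem timeDerivWithin_timeRescale {S S' : Set ℝ} {w : ℝ → X → F} (h : IsSmoothSpaceTimeOn S w)
    {a : ℝ} (c : ℝ) (hS' : MapsTo (fun s => a * s) S' S) (hU : UniqueDiffOn ℝ S') {s : ℝ}
    (hs : s ∈ S') (x : X) :
    timeDerivWithin S' (timeRescale a c w) s x = (c * a) • timeDerivWithin S w (a * s) x := by
  have hg : HasDerivWithinAt (fun t => w t x) (timeDerivWithin S w (a * s) x) S (a * s) := by
    rw [timeDerivWithin_apply]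
    exact (h.differentiableWithinAt_time (hS' hs) x).hasDerivWithinAt
  have hh : HasDerivWithinAt (fun s : ℝ => a * s) a S' s :=
    (hasDerivAt_const_mul a).hasDerivWithinAt
  have hsm := (hg.scomp s hh hS').const_smul c
  have hfun : (fun s' => timeRescale a c w s' x) = c • ((fun t => w t x) ∘ fun s : ℝ => a * s) := by
    funext s'
    simp
  rw [timeDerivWithin_apply, hfun, hsm.derivWithin (hU s hs), smul_smul]

end TimeRescale

/-! ### Scalar multiples under the differential operators of the system -/

section Operators

variable {E : Type*} [NormedAddCommGroup E] [InnerProductSpace ℝ E] [FiniteDimensional ℝ E]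
  [MeasurableSpace E] [BorelSpace E]
variable {F' : Type*} [NormedAddCommGroup F'] [InnerProductSpace ℝ F']

omit [FiniteDimensional ℝ E] [MeasurableSpace E] [BorelSpace E] in
/-- `((c u)·∇)(c u) = c² (u·∇)u` at a point of differentiability. [folklore] -/
theorem convect_const_smul_const_smul {u : E → E} {x : E} (hu : DifferentiableAt ℝ u x) (c : ℝ) :
    convect (fun y => c • u y) (fun y => c • u y) x = (c * c) • convect u u x := by
  simp only [convect_apply, fderiv_fun_const_smul hu, FunLike.coe_smul,
    Pi.smul_apply, map_smul, smul_smul]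

omit [FiniteDimensional ℝ E] [MeasurableSpace E] [BorelSpace E] in
/-- A scalar multiple of a differentiable divergence-free field is divergence free (tree
`divergence_const_smul_apply`, `PressurePoisson.lean`). [folklore] -/
theorem VectorCalculus.IsDivFree.const_smul {u : E → E} (hu : Differentiable ℝ u) (hdiv : VectorCalculus.IsDivFree u) (c : ℝ) :
    VectorCalculus.IsDivFree (fun y => c • u y) := fun x => by
  rw [divergence_const_smul_apply (hu x), hdiv x, mul_zero]

omit [MeasurableSpace E] [BorelSpace E] in
/-- `∇(c p) = c ∇p` at a point of differentiability (real scalars). [folklore] -/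
theorem gradient_const_smul {p : E → ℝ} {x : E} (hp : DifferentiableAt ℝ p x) (c : ℝ) :
    gradient (fun y => c • p y) x = c • gradient p x := by
  simp only [gradient, fderiv_fun_const_smul hp, map_smulₛₗ, starRingEnd_apply, star_trivial]

omit [MeasurableSpace E] [BorelSpace E] in
/-- The squared Frobenius norm is `2`-homogeneous: `|c L|² = c² |L|²`. This is verbatim the
tree's `Fluid.frobeniusNormSq_smul` (`SpaceTimeRescaling.lean`), restated here only to keep the
weak-solution imports of that file out of the classical closed-slab files (refactor note: a
librarian may move `frobeniusNormSq_smul` next to `frobeniusNormSq` in `VectorCalculus` and delete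
this copy). [folklore] -/
theorem frobeniusNormSq_const_smul (c : ℝ) (L : E →L[ℝ] F') :
    frobeniusNormSq (c • L) = c ^ 2 * frobeniusNormSq L := by
  simp only [frobeniusNormSq, FunLike.coe_smul, Pi.smul_apply, norm_smul, mul_pow,
    Real.norm_eq_abs, sq_abs, Finset.mul_sum]

end Operators

/-! ### The rescaled classical solution -/

section Solution

variable {E : Type*} [NormedAddCommGroup E] [InnerProductSpace ℝ E] [FiniteDimensional ℝ E]

/-- **Viscosity rescaling of classical solutions (Tao 2011, footnote 3), general time sets.**
If `(u, p)` solves `∂ₜu + (u·∇)u = νΔu − ∇p + f`, `div u = 0` classically on `S × E` with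
`ν ≠ 0`, and `S'` is a set of unique differentiability mapped into `S` by `s ↦ ν⁻¹s`, then
`v = ν⁻¹u(ν⁻¹·)`, `q = ν⁻²p(ν⁻¹·)`, `g = ν⁻²f(ν⁻¹·)` solve the system with viscosity `1`
classically on `S' × E`: multiply the momentum equation at time `ν⁻¹s` by `ν⁻²` and use
`∂ₛv = ν⁻²(∂ₜu)(ν⁻¹s)`, `(v·∇)v = ν⁻²(u·∇)u`, `Δv = ν⁻¹Δu`, `∇q = ν⁻²∇p`. [cite: Tao2011, footnote 3] -/
theorem IsClassicalNSSolutionOn.viscosityRescale_set {S S' : Set ℝ} {ν : ℝ} {f u : ℝ → E → E}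
    {p : ℝ → E → ℝ} (h : IsClassicalNSSolutionOn S ν f u p) (hν : ν ≠ 0)
    (hS' : MapsTo (fun s => ν⁻¹ * s) S' S) (hU : UniqueDiffOn ℝ S') :
    IsClassicalNSSolutionOn S' 1 (timeRescale ν⁻¹ (ν⁻¹ ^ 2) f) (timeRescale ν⁻¹ ν⁻¹ u)
      (timeRescale ν⁻¹ (ν⁻¹ ^ 2) p) where
  smooth_velocity := h.smooth_velocity.timeRescale _ _ hS'
  smooth_pressure := h.smooth_pressure.timeRescale _ _ hS'
  momentum s hs x := by
    have ht : ν⁻¹ * s ∈ S := hS' hs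
    set t : ℝ := ν⁻¹ * s with htdef
    have hmom := h.momentum t ht x
    have hu2 : ContDiff ℝ 2 (u t) := (h.contDiff_velocity ht).of_le (by norm_cast)
    have hud : DifferentiableAt ℝ (u t) x := (hu2.differentiable (by norm_num)) x
    have hpd : DifferentiableAt ℝ (p t) x :=
      ((h.contDiff_pressure ht).differentiable (by simp)) x
    have hlap : (Δ fun y => ν⁻¹ • u t y) x = ν⁻¹ • (Δ (u t)) x := by
      rw [show (fun y => ν⁻¹ • u t y) = ν⁻¹ • u t from rfl]
      exact laplacian_smul ν⁻¹ hu2.contDiffAt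
    rw [timeDerivWithin_timeRescale h.smooth_velocity ν⁻¹ hS' hU hs x, timeRescale_slice,
      timeRescale_slice, timeRescale_apply, convect_const_smul_const_smul hud,
      hlap, gradient_const_smul hpd, one_smul, ← htdef]
    have key : (ν⁻¹ * ν⁻¹) • (timeDerivWithin S u t x + convect (u t) (u t) x) =
        (ν⁻¹ * ν⁻¹) • (ν • (Δ (u t)) x - gradient (p t) x + f t x) := by rw [hmom]
    rw [smul_add] at key
    rw [key, smul_add, smul_sub, smul_smul, sq]
    congr 2
    rw [mul_assoc, inv_mul_cancel₀ hν, mul_one]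
  divFree s hs := by
    rw [timeRescale_slice]
    have ht : ν⁻¹ * s ∈ S := hS' hs
    exact (h.divFree _ ht).const_smul ((h.contDiff_velocity ht).differentiable (by simp)) _

/-- `s ↦ ν⁻¹ s` maps `[0, νT]` into `[0, T]` for `ν > 0`. [folklore] -/
theorem mapsTo_inv_mul_Icc {ν T : ℝ} (hν : 0 < ν) :
    MapsTo (fun s => ν⁻¹ * s) (Icc 0 (ν * T)) (Icc 0 T) := by
  intro s hs
  refine ⟨mul_nonneg (inv_nonneg.2 hν.le) hs.1, ?_⟩
  calc ν⁻¹ * s ≤ ν⁻¹ * (ν * T) := mul_le_mul_of_nonneg_left hs.2 (inv_nonneg.2 hν.le)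
    _ = T := by rw [← mul_assoc, inv_mul_cancel₀ hν.ne', one_mul]

/-- `s ↦ ν⁻¹ s` maps `(0, νT)` into `(0, T)` for `ν > 0`, and conversely. [folklore] -/
theorem inv_mul_mem_Ioo_iff {ν T s : ℝ} (hν : 0 < ν) :
    ν⁻¹ * s ∈ Ioo 0 T ↔ s ∈ Ioo 0 (ν * T) := by
  have hν' : 0 < ν⁻¹ := inv_pos.2 hν
  constructor
  · rintro ⟨h1, h2⟩
    refine ⟨by nlinarith [mul_pos_iff_of_pos_left hν' |>.1 h1], ?_⟩
    have : ν * (ν⁻¹ * s) < ν * T := mul_lt_mul_of_pos_left h2 hν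
    rwa [← mul_assoc, mul_inv_cancel₀ hν.ne', one_mul] at this
  · rintro ⟨h1, h2⟩
    refine ⟨mul_pos hν' h1, ?_⟩
    calc ν⁻¹ * s < ν⁻¹ * (ν * T) := mul_lt_mul_of_pos_left h2 hν'
      _ = T := by rw [← mul_assoc, inv_mul_cancel₀ hν.ne', one_mul]

/-- **Viscosity rescaling of classical solutions on the closed slab (Tao 2011, footnote 3).** If
`(u, p)` is a classical solution with viscosity `ν > 0` on `[0, T] × E`, then
`v(s, x) = ν⁻¹u(s/ν, x)`, `q(s, x) = ν⁻²p(s/ν, x)`, `g(s, x) = ν⁻²f(s/ν, x)` form a classical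
solution with viscosity `1` on `[0, νT] × E`. [cite: Tao2011, footnote 3] -/
theorem IsClassicalNSSolutionOn.viscosityRescale {T ν : ℝ} {f u : ℝ → E → E} {p : ℝ → E → ℝ}
    (h : IsClassicalNSSolutionOn (Icc 0 T) ν f u p) (hν : 0 < ν) (hT : 0 < T) :
    IsClassicalNSSolutionOn (Icc 0 (ν * T)) 1 (timeRescale ν⁻¹ (ν⁻¹ ^ 2) f)
      (timeRescale ν⁻¹ ν⁻¹ u) (timeRescale ν⁻¹ (ν⁻¹ ^ 2) p) :=
  h.viscosityRescale_set hν.ne' (mapsTo_inv_mul_Icc hν) (uniqueDiffOn_Icc (mul_pos hν hT))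

omit [FiniteDimensional ℝ E] in
/-- The homogeneous case: the rescaled zero force is zero. [folklore] -/
@[simp]
theorem timeRescale_zero_force (a c : ℝ) :
    timeRescale a c (0 : ℝ → E → E) = 0 := by
  funext s x
  simp [timeRescale]

/-- **Viscosity rescaling, unforced case**: a classical solution of the unforced system with
viscosity `ν > 0` on `[0, T] × E` rescales to one with viscosity `1` on `[0, νT] × E`. [cite: Tao2011, footnote 3] -/
theorem IsClassicalNSSolutionOn.viscosityRescale_zero {T ν : ℝ} {u : ℝ → E → E} {p : ℝ → E → ℝ}
    (h : IsClassicalNSSolutionOn (Icc 0 T) ν 0 u p) (hν : 0 < ν) (hT : 0 < T) :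
    IsClassicalNSSolutionOn (Icc 0 (ν * T)) 1 0 (timeRescale ν⁻¹ ν⁻¹ u)
      (timeRescale ν⁻¹ (ν⁻¹ ^ 2) p) := by
  simpa using h.viscosityRescale hν hT

end Solution

/-! ### Bookkeeping: energy, vorticity, dissipation, time integrals -/

section Norms

variable {α : Type*} [MeasurableSpace α]
variable {F : Type*} [NormedAddCommGroup F] [NormedSpace ℝ F]

/-- Kinetic energy of a scalar multiple: `∫ |c w|² = c² ∫ |w|²` (lower Lebesgue integrals). [folklore] -/
theorem lintegral_enorm_sq_const_smul (μ : Measure α) (c : ℝ) (w : α → F) :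
    ∫⁻ x, ‖c • w x‖ₑ ^ 2 ∂μ = ENNReal.ofReal (c ^ 2) * ∫⁻ x, ‖w x‖ₑ ^ 2 ∂μ := by
  have hc : ‖c‖ₑ ^ 2 = ENNReal.ofReal (c ^ 2) := by
    rw [Real.enorm_eq_ofReal_abs, ← ENNReal.ofReal_pow (abs_nonneg c), sq_abs]
  rw [← hc, ← lintegral_const_mul' _ _ (by simp)]
  refine lintegral_congr fun x => ?_
  rw [enorm_smul, mul_pow]

end Norms

section NormsR3

/-- Local notation for physical space `ℝ³ = EuclideanSpace ℝ (Fin 3)`. -/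
local notation "ℝ³" => EuclideanSpace ℝ (Fin 3)

/-- Vorticity of a scalar multiple of a differentiable field: `curl (c v) = c curl v`
(everywhere). [folklore] -/
theorem curl_const_smul_eq {v : ℝ³ → ℝ³} (hv : Differentiable ℝ v) (c : ℝ) :
    curl (fun y => c • v y) = fun x => c • curl v x :=
  funext fun x => curl_const_smul (hv x) c

/-- Gradient of the vorticity of a scalar multiple: `D(curl (c v)) = c D(curl v)` for `C²`
fields. [folklore] -/
theorem fderiv_curl_const_smul {v : ℝ³ → ℝ³} (hv : ContDiff ℝ 2 v) (c : ℝ) (x : ℝ³) :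
    fderiv ℝ (curl fun y => c • v y) x = c • fderiv ℝ (curl v) x := by
  rw [curl_const_smul_eq (hv.differentiable (by norm_num)) c]
  have hd : DifferentiableAt ℝ (curl v) x := by
    rw [curl_eq_curlCLM_comp]
    have h1 : DifferentiableAt ℝ (fderiv ℝ v) x :=
      ((hv.fderiv_right (m := 1) (by norm_num)).differentiable one_ne_zero).differentiableAt
    exact curlCLM.differentiableAt.comp x h1
  exact fderiv_fun_const_smul hd c

end NormsR3

/-! ### Time change of variables for lower Lebesgue integrals -/

section Time

/-- **Linear change of variables on `ℝ` for the lower Lebesgue integral** (no measurability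
needed): `∫ G(a s) ds = |a⁻¹| ∫ G(t) dt` for `a ≠ 0` (Mathlib `Real.map_volume_mul_left` and
`lintegral_map_equiv`; the `E = ℝ` case of the tree's `Fluid.lintegral_comp_smul`,
`SolenoidalTruncation.lean`). [folklore] -/
theorem lintegral_comp_mul_left_eq (G : ℝ → ℝ≥0∞) {a : ℝ} (ha : a ≠ 0) :
    ∫⁻ s, G (a * s) = ENNReal.ofReal |a⁻¹| * ∫⁻ t, G t := by
  have h1 : ∫⁻ s, G (a * s) = ∫⁻ t, G t ∂(Measure.map (fun s => a * s) volume) := by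
    rw [show (fun s => a * s) = ⇑(Homeomorph.mulLeft₀ a ha).toMeasurableEquiv from rfl,
      lintegral_map_equiv]
    rfl
  rw [h1, Real.map_volume_mul_left ha, lintegral_smul_measure, smul_eq_mul]

/-- **Time change of variables `s = νt` on `(0, νT)`**: `∫₀^{νT} G(ν⁻¹s) ds = ν ∫₀ᵀ G(t) dt`
for `ν > 0` and any `G : ℝ → ℝ≥0∞`. [folklore] -/
theorem setLIntegral_Ioo_comp_inv_mul (G : ℝ → ℝ≥0∞) {ν : ℝ} (hν : 0 < ν) (T : ℝ) :
    ∫⁻ s in Ioo 0 (ν * T), G (ν⁻¹ * s) = ENNReal.ofReal ν * ∫⁻ t in Ioo 0 T, G t := by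
  have hν' : ν⁻¹ ≠ 0 := inv_ne_zero hν.ne'
  rw [← lintegral_indicator measurableSet_Ioo, ← lintegral_indicator measurableSet_Ioo]
  have hind : (fun s => (Ioo 0 (ν * T)).indicator (fun s => G (ν⁻¹ * s)) s) =
      fun s => (Ioo 0 T).indicator G (ν⁻¹ * s) := by
    funext s
    by_cases hs : s ∈ Ioo 0 (ν * T)
    · rw [indicator_of_mem hs, indicator_of_mem ((inv_mul_mem_Ioo_iff hν).2 hs)]
    · rw [indicator_of_notMem hs, indicator_of_notMem (mt (inv_mul_mem_Ioo_iff hν).1 hs)]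
  rw [hind, lintegral_comp_mul_left_eq _ hν', inv_inv, abs_of_pos hν]

end Time

end Literature.Analysis.FluidPDE

end
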